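import Summits.QuantumFields.YangMills.Theorems.UnitScaleTiltFluctuationComparisonRegPrGlobalSlackLegNaturalRowsTwoRunDoorSel
import Summits.QuantumFields.YangMills.Theorems.UnitScaleTiltFluctuationComparisonRegPrGlobalSlackLegNaturalChartAnalyticTop
import Summits.QuantumFields.YangMills.Theorems.UnitScaleTiltFluctuationComparisonRegPrGlobalSlackLegKernelBudgetPointwise
import HarnessLib

/-!
# `UnitScaleTiltFluctuationComparisonRegPrGlobalSlackLegNaturalRowsTwoRunDoorSelLocal` — THE NATURAL-OBJECT DOOR OF 3⁗χ(v4), SELECTED ANCHOR, WITH THE ANALYTICITY ROW TRADED FOR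
# PRINT-SHAPED LETTERS: THE TWO-RUN DISPLAY FROM (43)-AS-DEFINITION, p.263 L4 LOCALITY, THE (43) KERNEL DECAY (summed OR print's pointwise form) AND EXACTLY THE TWO ONE-FAMILY
# TWO-RUN ROWS (crux `FluctuationComparisonRegPrIntL`, stmt-QuantumFields-20520, skeleton v5kD, STUB 3⁗χ(v4) `stub_globalTwoRunSlackFamChiV4`; LEAD ym-ust-20520-w2 g5, (B7) of ★★OWNER
# ACK 50 (4)/51 (2) «GO-(B)»; count-neutral helper, def-free, registry untouched)

WHY.  ✓`k1aLegRowsDisplayTwoRunChiAtV4_of_kernelRowsSel` (`…NaturalRowsTwoRunDoorSel` §2, this seat) reduces the two-run display `K1aLegRowsDisplayTwoRunChiAtV4` — hence the DECIDING crux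
modulo T8 and 2′χ(v4) (✓`InteriorExcision.regPrIntL_of_T8_recChiV4_k1aLegRowsDisplayTwoRunChiAtV4_allL`) — for the natural objects `(Φ♮[birthChartRows q, N], 0, B♮[sel])` to print's (43)
kernel row, (K) `FlatKernelLegCauchyΦ`[Φ♮], (A) `ChartAnalyticΦ`[rescaleΦw Φ♮] and (BC) `CfgDistCauchyΦ`[B♮[sel]].  ym-inputs-p11 g3's ✓p636128 ★★`chartAnalyticΦ_rescaleW_naturalChart_chiV4_of_loc_ker`
supplies (A) from EXACTLY two print-shaped letters — (ℓ) LOCALITY of the retained charts (p.263 L4) and (k) the (43) KERNEL BUDGET at the listed blocks — the birth charts' analyticity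
being THE RECORD's (G3D-01/G3D-07) and both dummy-top clauses being theorems for `Φ♮`; this seat's ✓p636084 `kernelBudget_of_pointwise` supplies (k) from print's POINTWISE (43) decay.
THIS FILE composes:

* ★★★ **`k1aLegRowsDisplayTwoRunChiAtV4_of_kernelRowsSel_of_loc_ker`** (`1 < L < 𝔠.M₁`, `p₁ ≥ p₀ + r₀`, `sel F K b Y ∈ anchors K b Y`): display ⇐ ∃ `κ′ R C C_A(≥ C25+C63) C_B γB`,
  ∀ F γ ≤ γB, `OfV4ChiAt` → ∃ p coherent, ∃ N: (43) kernel row · (K)[Φ♮] · (ℓ) · (k) · (BC)[B♮[sel F]];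
* ★★★ **`k1aLegRowsDisplayTwoRunChiAtV4_of_kernelRowsSel_of_loc_pointwise`**: the same with (k) replaced by (k₀) print's pointwise decay `‖N K b y n c‖ ≤ A·Πᵢ e^{−κ₁ d(cᵢ)}`, `κ₁ > κ′`.
  SO at the natural objects with a selected anchor 3⁗χ(v4)'s display residue reads: (43) = THE DEFINITION of `oldVal` in print's form; (k₀) = print's (43) decay; (ℓ) = print's p.263 L4
  locality; and (K)/(BC) = THE TWO cross-cut-off rows, UNPRINTED for non-abelian `d = 3` (E2 = NO) — at p12 g6's run-coherent selector (BC) further reduces to B0's new-level coherence +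
  (Fine_b) (✓`cfgDistCauchyΦ_naturalCoherent_of_newLevel_of_fine`); every other row of the display is a theorem of the tree.

HONEST SCOPE.  Compositions of landed reductions; (43), (K), (ℓ), (k)/(k₀), (BC) are HYPOTHESES, not asserted; nothing of [Balaban1985UV3] / [King1986] is asserted; no stub / crux /
registry object touched (`--supports stmt-QuantumFields-20520`); no summit / rung / gap claim (YM₃ on T³ is ladder rung R3, not the Clay problem).  L-floor: none beyond `1 < L`; `L < M₁`
is print's big-block letter.

References: T. Bałaban, CMP 102 (1985) 255–275 [Balaban1985UV3] (p.263 L4, (24)–(25) p.262, (27)–(30) p.263, (33)–(34) p.264, (43)–(45) pp.266–267, (59)–(63) pp.270–272); C. King,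
CMP 102 (1986) 649–677 [King1986] (Thm 3.4 (3.9) p.656, Prop. 3.6 (3.56) p.662, Prop. 3.9 (3.71)–(3.74) p.665); CMP 109 (1987) 249–301 [Balaban1987RG1] ((0.1) p.251).
-/

set_option autoImplicit false

noncomputable section

open scoped Matrix.Norms.L2Operator Nat
open Literature.MathematicalPhysics.QuantumFieldTheory.Balaban1983to89
open Literature.MathematicalPhysics.QuantumFieldTheory.Balaban1983to89.T3ContinuumYM3Torus
open Literature.MathematicalPhysics.QuantumFieldTheory.Balaban1983to89.T3UnitLawDensityEML (ℰp)
open Literature.MathematicalPhysics.QuantumFieldTheory.Balaban1983to89.T3UnitScaleTilt (θBal)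
open Literature.MathematicalPhysics.QuantumFieldTheory.Balaban1983to89.T3LevelShift (fieldShift)
open Literature.MathematicalPhysics.QuantumFieldTheory.Balaban1983to89.T3AlphaInputsAC (AlphaDataT3)
open Literature.MathematicalPhysics.QuantumFieldTheory.Balaban1983to89.TreeLengthTorus (tsys)
open Literature.MathematicalPhysics.QuantumFieldTheory.Balaban1983to89.B10Eq27TorusAxialLog
open Literature.MathematicalPhysics.QuantumFieldTheory.Balaban1983to89.B7Prop1Explicit (l1)
open Literature.MathematicalPhysics.QuantumFieldTheory.Balaban1983to89.ExpMeanLog (deltaSU deltaSU_pos)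
open Literature.MathematicalPhysics.QuantumFieldTheory.Balaban1985CMP102
open Literature.MathematicalPhysics.QuantumFieldTheory.Balaban1985CMP102.Setting
open Literature.MathematicalPhysics.QuantumFieldTheory.Balaban1985CMP102.Binders (ChartAnalyticityAsCited)
open Summit.QuantumFields.Balaban3D.Carriers
open Summit.QuantumFields.Balaban3D.Proofs.Primitives
open Summit.QuantumFields.Balaban3D.Proofs.GroupModelLieC (vecE lieC)
open Summit.QuantumFields.YangMills.Theorems
open Summit.QuantumFields.YangMills.Theorems.GlobalSlackKernelMatching
open Summit.QuantumFields.YangMills.Theorems.GlobalSlackCanonicalPolymers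

namespace Summit.QuantumFields.YangMills.Theorems.GlobalSlackKernelLeg

variable (sel : (F : T3Family) → (K b : ℕ) → Set (Site (F.P K) 0) → Site (F.P K) b)
  (hsel : ∀ (F : T3Family) (K b : ℕ) (Y : Set (Site (F.P K) 0)), sel F K b Y ∈ anchors K b Y)

include hsel

/-! ## §1 The door with (A) from locality + the (43) kernel budget -/

open Classical in
/-- ★★★ **THE TWO-RUN DISPLAY OF 3⁗χ(v4) FROM (43)-AS-DEFINITION, LOCALITY, THE (43) KERNEL BUDGET AND THE TWO ONE-FAMILY TWO-RUN ROWS, AT THE NATURAL OBJECTS WITH A SELECTED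
ANCHOR** `(Φ♮[birthChartRows q, N], 0, B♮[sel F])` (`q = toRows ∘ p`; `1 < L < 𝔠.M₁`, `p₁ ≥ p₀ + r₀`, `sel F K b Y ∈ anchors K b Y`): ✓`k1aLegRowsDisplayTwoRunChiAtV4_of_kernelRowsSel` with its
analyticity row (A) supplied by ym-inputs-p11 g3's ✓`chartAnalyticΦ_rescaleW_naturalChart_chiV4_of_loc_ker` (radius `𝔠.ρ·e^{−κ′R}`, decay `𝔠.κ`, BOTH dummy-top clauses being theorems for
`Φ♮`).  Displayed letters: (43) print's kernel row on the record's old terms (the definition of `oldVal`), (K) `FlatKernelLegCauchyΦ`[Φ♮], (ℓ) locality of the retained charts at leg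
distance `R` (print p.263 L4), (k) the (43) kernel budget at the listed blocks, (BC) `CfgDistCauchyΦ`[B♮[sel F]] — (K)/(BC) = THE TWO cross-cut-off rows, UNPRINTED for non-abelian
`d = 3` (E2 = NO), well-posed at a run-coherent `sel`. [cite: Balaban1985UV3, p.263 L4, (25) p.262, (27)-(30) p.263, (33)-(34) p.264, (43)-(45) pp.266-267, (59)-(63) pp.270-272; King1986, Prop. 3.6 (3.56) p.662, Prop. 3.9 (3.71)-(3.74) p.665] -/
theorem k1aLegRowsDisplayTwoRunChiAtV4_of_kernelRowsSel_of_loc_ker {L : ℕ} (hL : 1 < L) {𝔠 : AlphaConsts L (suGroupModel 2).N} (hM : L < 𝔠.M₁) {a₀ a₁ a p₁ : ℝ}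
    (ha₀ : 0 < a₀) (ha₁ : 0 < a₁) (hp₁ : 𝔠.p₀ + 𝔠.r₀ ≤ p₁)
    (h : ∃ (κ' R C C_A C_B γB : ℝ), 0 < κ' ∧ 0 ≤ C ∧ 𝔠.C25 + 𝔠.C63 ≤ C_A ∧ 0 ≤ C_B ∧ 0 < γB ∧
      ∀ (F : T3Family) (γ : ℝ) (hF : F.L = L) (hγ : 0 < γ), γ ≤ γB → ∀ (hγ1 : γ ≤ (min (hF ▸ 𝔠).gamma0 1) ^ 2),
        AlphaInputsT3AC.OfV4ChiAt F (hF ▸ 𝔠) a₀ a₁ →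
          ∃ (p : ∀ K, AlphaInputsT3AC.PkgAtV4Chi F (hF ▸ 𝔠) γ hγ hγ1 K), (∀ K, (p K).a₀ = a₀ ∧ (p K).a₁ = a₁) ∧
            ∃ (N : (K b : ℕ) → Site (F.P K) (1 + b) → (n : ℕ) → (Fin n → PBond (F.P K) b) →
                ContinuousMultilinearMap ℂ (fun _ : Fin n => ↥(lieC (suGroupModel 2))) ℂ),
              (∀ (K k : ℕ), k + 1 ≤ K → ∀ j : ℕ, j < k →
                ∀ y ∈ oldBlocks (hF ▸ 𝔠).lane.carrier.M₁ (rcolOf (SK F (hF ▸ 𝔠) γ hγ hγ1 K) (hF ▸ 𝔠).lane.carrier) (Hist.triv (F.P K) (k + 1)) (1 + j),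
                  ∀ W : GaugeField (F.P K) (k + 1) (Matrix.specialUnitaryGroup (Fin 2) ℂ),
                    oldTermRows (fun K => (p K).toRows) K k (1 + j) y W =
                      (∑ n ∈ Finset.Ico 2 7, ((n ! : ℂ))⁻¹ * ∑ c : Fin n → PBond (F.P K) j, N K j y n c (fun i =>
                        (fun K k b Y W c =>
                          if h : b + 1 = k then birthCfgAtRows (fun K => (p K).toRows) K b Y (h ▸ W) c
                          else if (l1 (rel (sel F K b Y) c.src) : ℝ) *
                              (2 * ((hF ▸ 𝔠).B₃ * θBal F.L γ (hF ▸ 𝔠).b₀ p₁ (K - k)) * (((F.L : ℝ) ^ (k - b))⁻¹) ^ 2) ≤ 1 / 2 then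
                            (lieC (suGroupModel 2)).orthogonalProjectionOnto
                              (vecE (suGroupModel 2).N
                                (B27T (unitsField (toUField (Averaging.iter (fun i => BlockAveraging.blockAvg (P := F.P K) (j := i) ℰp) b
                                  ((p K).UkH k (Hist.triv (F.P K) k) W)))) (sel F K b Y) c))
                          else 0) K (k + 1) j (blockSet K (1 + j) y) W (c i))).re) ∧
              FlatKernelLegCauchyΦ (AlphaInputsT3AC.dataOfV4chi p (canonPolymerRows fun K => (p K).toRows))
                (fun K b Y =>
                  if h : ∃ y : Site (F.P K) (1 + b), blockSet K (1 + b) y = Y then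
                    (fun x : PBond (F.P K) b → ↥(lieC (suGroupModel 2)) =>
                      ∑ n ∈ Finset.Ico 2 7, ((n ! : ℂ))⁻¹ * ∑ c : Fin n → PBond (F.P K) b, N K b h.choose n c (fun i => x (c i)))
                  else birthChartRows (fun K => (p K).toRows) K b Y)
                (canonLegDist F) κ' (hF ▸ 𝔠).κ a C ∧
              -- (ℓ) locality of the retained charts at leg distance `R`
              (∀ (K b : ℕ), b + 1 ≤ K → ∀ X ∈ newDomsRows (fun K => (p K).toRows) K b (Hist.triv (F.P K) (b + 1)),
                ∀ z : PBond (F.P K) b → ↥(lieC (suGroupModel 2)),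
                  (((p K).toRows).𝔖 b).Ψ X z =
                    (((p K).toRows).𝔖 b).Ψ X (fun c => if canonLegDist F K b (domSet (F := F) (hF ▸ 𝔠).lane.carrier.M₁ K b X) c ≤ R then z c else 0) ∧
                  (((p K).toRows).𝔄.Λc b).Ψ X z =
                    (((p K).toRows).𝔄.Λc b).Ψ X (fun c => if canonLegDist F K b (domSet (F := F) (hF ▸ 𝔠).lane.carrier.M₁ K b X) c ≤ R then z c else 0)) ∧
              -- (k) the (43) kernel budget at the listed blocks, radius `𝔠.ρ·e^{−κ′R}`
              (∀ (K k b : ℕ) (y : Site (F.P K) (1 + b)),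
                blockSet K (1 + b) y ∈ canonLocRows (fun K => (p K).toRows) K k (Hist.triv (F.P K) k) (1 + b) →
                  ∑ n ∈ Finset.Ico 2 7, ((n ! : ℝ))⁻¹ * ∑ c : Fin n → PBond (F.P K) b,
                    ‖N K b y n c‖ * (∏ i, Real.exp (κ' * canonLegDist F K b (blockSet K (1 + b) y) (c i))) *
                      ((hF ▸ 𝔠).ρ * Real.exp (-(κ' * R)) / 2) ^ n ≤
                    C_A * Real.exp (-(hF ▸ 𝔠).κ *
                      (AlphaInputsT3AC.dataOfV4chi p (canonPolymerRows fun K => (p K).toRows)).treeLen K (1 + b) (blockSet K (1 + b) y))) ∧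
              CfgDistCauchyΦ (AlphaInputsT3AC.dataOfV4chi p (canonPolymerRows fun K => (p K).toRows))
                (fun K k b Y W c =>
                  if h : b + 1 = k then birthCfgAtRows (fun K => (p K).toRows) K b Y (h ▸ W) c
                  else if (l1 (rel (sel F K b Y) c.src) : ℝ) *
                      (2 * ((hF ▸ 𝔠).B₃ * θBal F.L γ (hF ▸ 𝔠).b₀ p₁ (K - k)) * (((F.L : ℝ) ^ (k - b))⁻¹) ^ 2) ≤ 1 / 2 then
                    (lieC (suGroupModel 2)).orthogonalProjectionOnto
                      (vecE (suGroupModel 2).N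
                        (B27T (unitsField (toUField (Averaging.iter (fun i => BlockAveraging.blockAvg (P := F.P K) (j := i) ℰp) b
                          ((p K).UkH k (Hist.triv (F.P K) k) W)))) (sel F K b Y) c))
                  else 0)
                (canonLegDist F) (hF ▸ 𝔠).b₀ p₁ a C_B) :
    K1aLegRowsDisplayTwoRunChiAtV4 L 𝔠 a₀ a₁ a p₁ := by
  obtain ⟨κ', R, C, C_A, C_B, γB, hκ', hC, hCA, hCB, hγB, hall⟩ := h
  have hCA0 : 0 ≤ C_A := le_trans (add_nonneg 𝔠.C25_nonneg 𝔠.C63_nonneg) hCA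
  have hρ : 0 < 𝔠.ρ * Real.exp (-(κ' * R)) := mul_pos 𝔠.ρ_pos (Real.exp_pos _)
  refine k1aLegRowsDisplayTwoRunChiAtV4_of_kernelRowsSel sel hsel hL hM ha₀ ha₁ hp₁
    ⟨κ', 𝔠.ρ * Real.exp (-(κ' * R)), C, C_A, C_B, γB, hκ', hρ, hC, hCA0, hCB, hγB, fun F γ hF hγ hγle hγ1 hOf => ?_⟩
  obtain ⟨p, hp, N, h43, hK, hloc, hker, hBC⟩ := hall F γ hF hγ hγle hγ1 hOf
  subst hF
  exact ⟨p, hp, N, h43, hK, chartAnalyticΦ_rescaleW_naturalChart_chiV4_of_loc_ker p N hκ'.le hCA hloc hker, hBC⟩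

/-! ## §2 The door with the kernel letter in print's pointwise form -/

open Classical in
/-- ★★★ **THE SAME WITH THE KERNEL LETTER IN PRINT'S LITERAL POINTWISE FORM**: (k₀) «`‖N K b y n c‖ ≤ A·Πᵢ e^{−κ₁ d(cᵢ)}`» at the listed blocks with a rate `κ₁ > κ′` (print's (43):
«|𝒫_j(Y_j)(c₁,…,c_n)| ≤ O(1) Πᵢ exp(−κ₁(M₁Lʲη)⁻¹|c_{i,−} − y|)») replaces the summed budget (k) — by this seat's ✓`kernelBudget_of_pointwise` (✓`legSummableT_canonRows`, `𝓛(block) ≤ L³`) with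
the constant `max (C25 + C63) (A·e^{𝔠.κ·L³}·Σ_{n∈[2,7)} (n!)⁻¹ (legSumConst(κ₁−κ′)(1+L³)·𝔠.ρ e^{−κ′R}/2)ⁿ)`.  So, at the natural objects with a selected anchor, 3⁗χ(v4)'s display residue is:
(43)-as-definition + (43)-pointwise-decay + p.263 L4 locality + EXACTLY the two one-family two-run rows (K)/(BC). [cite: Balaban1985UV3, p.263 L4, (24)-(25) p.262, (27)-(30) p.263, (43)-(45) pp.266-267, (59)-(63) pp.270-272; King1986, Prop. 3.6 (3.56) p.662, Prop. 3.9 (3.71)-(3.74) p.665] -/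
theorem k1aLegRowsDisplayTwoRunChiAtV4_of_kernelRowsSel_of_loc_pointwise {L : ℕ} (hL : 1 < L) {𝔠 : AlphaConsts L (suGroupModel 2).N} (hM : L < 𝔠.M₁) {a₀ a₁ a p₁ : ℝ}
    (ha₀ : 0 < a₀) (ha₁ : 0 < a₁) (hp₁ : 𝔠.p₀ + 𝔠.r₀ ≤ p₁)
    (h : ∃ (κ' κ₁ R C A C_B γB : ℝ), 0 < κ' ∧ κ' < κ₁ ∧ 0 ≤ C ∧ 0 ≤ A ∧ 0 ≤ C_B ∧ 0 < γB ∧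
      ∀ (F : T3Family) (γ : ℝ) (hF : F.L = L) (hγ : 0 < γ), γ ≤ γB → ∀ (hγ1 : γ ≤ (min (hF ▸ 𝔠).gamma0 1) ^ 2),
        AlphaInputsT3AC.OfV4ChiAt F (hF ▸ 𝔠) a₀ a₁ →
          ∃ (p : ∀ K, AlphaInputsT3AC.PkgAtV4Chi F (hF ▸ 𝔠) γ hγ hγ1 K), (∀ K, (p K).a₀ = a₀ ∧ (p K).a₁ = a₁) ∧
            ∃ (N : (K b : ℕ) → Site (F.P K) (1 + b) → (n : ℕ) → (Fin n → PBond (F.P K) b) →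
                ContinuousMultilinearMap ℂ (fun _ : Fin n => ↥(lieC (suGroupModel 2))) ℂ),
              (∀ (K k : ℕ), k + 1 ≤ K → ∀ j : ℕ, j < k →
                ∀ y ∈ oldBlocks (hF ▸ 𝔠).lane.carrier.M₁ (rcolOf (SK F (hF ▸ 𝔠) γ hγ hγ1 K) (hF ▸ 𝔠).lane.carrier) (Hist.triv (F.P K) (k + 1)) (1 + j),
                  ∀ W : GaugeField (F.P K) (k + 1) (Matrix.specialUnitaryGroup (Fin 2) ℂ),
                    oldTermRows (fun K => (p K).toRows) K k (1 + j) y W =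
                      (∑ n ∈ Finset.Ico 2 7, ((n ! : ℂ))⁻¹ * ∑ c : Fin n → PBond (F.P K) j, N K j y n c (fun i =>
                        (fun K k b Y W c =>
                          if h : b + 1 = k then birthCfgAtRows (fun K => (p K).toRows) K b Y (h ▸ W) c
                          else if (l1 (rel (sel F K b Y) c.src) : ℝ) *
                              (2 * ((hF ▸ 𝔠).B₃ * θBal F.L γ (hF ▸ 𝔠).b₀ p₁ (K - k)) * (((F.L : ℝ) ^ (k - b))⁻¹) ^ 2) ≤ 1 / 2 then
                            (lieC (suGroupModel 2)).orthogonalProjectionOnto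
                              (vecE (suGroupModel 2).N
                                (B27T (unitsField (toUField (Averaging.iter (fun i => BlockAveraging.blockAvg (P := F.P K) (j := i) ℰp) b
                                  ((p K).UkH k (Hist.triv (F.P K) k) W)))) (sel F K b Y) c))
                          else 0) K (k + 1) j (blockSet K (1 + j) y) W (c i))).re) ∧
              FlatKernelLegCauchyΦ (AlphaInputsT3AC.dataOfV4chi p (canonPolymerRows fun K => (p K).toRows))
                (fun K b Y =>
                  if h : ∃ y : Site (F.P K) (1 + b), blockSet K (1 + b) y = Y then
                    (fun x : PBond (F.P K) b → ↥(lieC (suGroupModel 2)) =>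
                      ∑ n ∈ Finset.Ico 2 7, ((n ! : ℂ))⁻¹ * ∑ c : Fin n → PBond (F.P K) b, N K b h.choose n c (fun i => x (c i)))
                  else birthChartRows (fun K => (p K).toRows) K b Y)
                (canonLegDist F) κ' (hF ▸ 𝔠).κ a C ∧
              -- (ℓ) locality of the retained charts at leg distance `R`
              (∀ (K b : ℕ), b + 1 ≤ K → ∀ X ∈ newDomsRows (fun K => (p K).toRows) K b (Hist.triv (F.P K) (b + 1)),
                ∀ z : PBond (F.P K) b → ↥(lieC (suGroupModel 2)),
                  (((p K).toRows).𝔖 b).Ψ X z =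
                    (((p K).toRows).𝔖 b).Ψ X (fun c => if canonLegDist F K b (domSet (F := F) (hF ▸ 𝔠).lane.carrier.M₁ K b X) c ≤ R then z c else 0) ∧
                  (((p K).toRows).𝔄.Λc b).Ψ X z =
                    (((p K).toRows).𝔄.Λc b).Ψ X (fun c => if canonLegDist F K b (domSet (F := F) (hF ▸ 𝔠).lane.carrier.M₁ K b X) c ≤ R then z c else 0)) ∧
              -- (k₀) print's POINTWISE (43) decay of the kernels at the listed blocks, rate `κ₁ > κ′`
              (∀ (K k b : ℕ) (y : Site (F.P K) (1 + b)),
                blockSet K (1 + b) y ∈ canonLocRows (fun K => (p K).toRows) K k (Hist.triv (F.P K) k) (1 + b) →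
                  ∀ n ∈ Finset.Ico 2 7, ∀ c : Fin n → PBond (F.P K) b,
                    ‖N K b y n c‖ ≤ A * ∏ i, Real.exp (-(κ₁ * canonLegDist F K b (blockSet K (1 + b) y) (c i)))) ∧
              CfgDistCauchyΦ (AlphaInputsT3AC.dataOfV4chi p (canonPolymerRows fun K => (p K).toRows))
                (fun K k b Y W c =>
                  if h : b + 1 = k then birthCfgAtRows (fun K => (p K).toRows) K b Y (h ▸ W) c
                  else if (l1 (rel (sel F K b Y) c.src) : ℝ) *
                      (2 * ((hF ▸ 𝔠).B₃ * θBal F.L γ (hF ▸ 𝔠).b₀ p₁ (K - k)) * (((F.L : ℝ) ^ (k - b))⁻¹) ^ 2) ≤ 1 / 2 then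
                    (lieC (suGroupModel 2)).orthogonalProjectionOnto
                      (vecE (suGroupModel 2).N
                        (B27T (unitsField (toUField (Averaging.iter (fun i => BlockAveraging.blockAvg (P := F.P K) (j := i) ℰp) b
                          ((p K).UkH k (Hist.triv (F.P K) k) W)))) (sel F K b Y) c))
                  else 0)
                (canonLegDist F) (hF ▸ 𝔠).b₀ p₁ a C_B) :
    K1aLegRowsDisplayTwoRunChiAtV4 L 𝔠 a₀ a₁ a p₁ := by
  obtain ⟨κ', κ₁, R, C, A, C_B, γB, hκ', hκ₁, hC, hA, hCB, hγB, hall⟩ := h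
  have hρ0 : 0 ≤ 𝔠.ρ * Real.exp (-(κ' * R)) := (mul_pos 𝔠.ρ_pos (Real.exp_pos _)).le
  set C_A : ℝ := max (𝔠.C25 + 𝔠.C63) (A * Real.exp (𝔠.κ * (L : ℝ) ^ 3) *
      ∑ n ∈ Finset.Ico 2 7, ((n ! : ℝ))⁻¹ * (legSumConst L 𝔠 (κ₁ - κ') * (1 + (L : ℝ) ^ 3) * (𝔠.ρ * Real.exp (-(κ' * R)) / 2)) ^ n) with hCAdef
  have hCA : 𝔠.C25 + 𝔠.C63 ≤ C_A := le_max_left _ _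
  refine k1aLegRowsDisplayTwoRunChiAtV4_of_kernelRowsSel_of_loc_ker sel hsel hL hM ha₀ ha₁ hp₁
    ⟨κ', R, C, C_A, C_B, γB, hκ', hC, hCA, hCB, hγB, fun F γ hF hγ hγle hγ1 hOf => ?_⟩
  obtain ⟨p, hp, N, h43, hK, hloc, hpt, hBC⟩ := hall F γ hF hγ hγle hγ1 hOf
  subst hF
  refine ⟨p, hp, N, h43, hK, hloc, fun K k b y hY => ?_, hBC⟩
  have hb := kernelBudget_of_pointwise (fun K => (p K).toRows) N hκ₁ (kappa_record_admissible 𝔠).1.le hA hρ0 hpt K k b y hY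
  exact hb.trans (mul_le_mul_of_nonneg_right (le_max_right _ _) (Real.exp_pos _).le)

end Summit.QuantumFields.YangMills.Theorems.GlobalSlackKernelLeg

end
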